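import Summits.CriticalPhenomena.PercolationContinuityZ3.Theorems.SahiConjectureLayerCake
import Literature.Combinatorics.Sahi2008.UnderlyingIndependents

/-!
# Sahi's `C_n` for FKG posets ⟺ `C_n` for product measures; `SahiConjecture 3 ⟺ KahnConjecture`

Companion of `SahiConjecture.lean` / `SahiConjectureLayerCake.lean` (cell `prim-sahi`, typer;
`--supports stmt-CriticalPhenomena-4575`).  Kahn [Kahn2022, p. 3]: Sahi's conjecture "is stated in [10]
for FKG measures, but this is no more general since FKG measures are FUI" — every FKG probability weight
on a finite distributive lattice is the law of a monotone function of finitely many independent coins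
[Kahn2022, p. 2 footnote 1 (van den Berg)], now a tree theorem
(`Literature.Combinatorics.Sahi2008.IsFKGMeasure.exists_coinRepresentation`,
`Literature/Combinatorics/Sahi2008/UnderlyingIndependents.lean`), and Sahi positivity of every order
travels along monotone maps (`Literature.Combinatorics.Sahi2008.SahiPositive.of_pushWeight`).
Consequently the two typed obligations of this directory collapse:

* `sahiConjecture_iff_forall_bernoulliWeight n` — `SahiConjecture n` (all finite distributive lattices,
  all FKG probability weights) is EQUIVALENT to its product-measure case
  `∀ ι p, SahiPositive (bernoulliWeight p) n` (product weights on finite cubes `Set ι`), for every `n`;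
* `sahiConjecture_three_iff_kahnConjecture` — with the layer cake (`kahnConjecture_iff_sahiPositive`),
  `SahiConjecture 3 ↔ KahnConjecture`: Kahn's Conjecture 5 (product measures, three increasing
  events) is the WHOLE of Sahi's `C_3`.

So every conditional of `SahiConjecture.lean` / `…E3GroupSepOfSahi.lean` stated from `KahnConjecture`
is, without loss, a conditional on `C_3`, and conversely; and a proof (or refutation) of `C_n` may be
sought on product measures on finite cubes only.  Nothing here asserts either conjecture (both remain
`[status: open]`); the equivalences are stated with head `↔` between the two obligations.
-/

noncomputable section

namespace Summit.CriticalPhenomena.PercolationContinuityZ3.Theorems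

open Literature.Combinatorics.Sahi2008

/-- **`C_n` for FKG posets ⟺ `C_n` for product measures** (Kahn: "no more general since FKG measures
are FUI"): for every `n`, `SahiConjecture n ↔ ∀ (ι : Type) [Fintype ι] (p : ι → [0,1]),
SahiPositive (bernoulliWeight p) n`.  (→: product weights are FKG posets,
`isFKGMeasure_bernoulliWeight`; ←: `SahiPositive.of_isFKGMeasure_of_forall_bernoulliWeight`, i.e. the
coin representation of FKG weights + positivity along monotone maps.)
[cite: Kahn2022, p. 3 (before Conj. 5) and p. 2 footnote 1; LiebSahi2021, Conj. 1.1] -/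
theorem sahiConjecture_iff_forall_bernoulliWeight (n : ℕ) :
    SahiConjecture n ↔
      ∀ (ι : Type) [Fintype ι] (p : ι → unitInterval), SahiPositive (bernoulliWeight p) n :=
  ⟨fun hC ι _ p => hC (Set ι) (bernoulliWeight p) (isFKGMeasure_bernoulliWeight p),
    fun h _ _ _ _ hμ => SahiPositive.of_isFKGMeasure_of_forall_bernoulliWeight h hμ⟩

/-- **`SahiConjecture 3 ↔ KahnConjecture`**: Kahn's Conjecture 5 [Kahn2022] (product measures, three
increasing events) is equivalent to Sahi's `C_3` [Sahi2008, Conj. 5 at `n = 3`; LiebSahi2021, Conj. 1.1]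
over all FKG posets (layer cake `kahnConjecture_iff_sahiPositive` + FKG measures are FUI).
[cite: Kahn2022, p. 3 (Conj. 5 and the preceding remark); Sahi2008, Conj. 5 (p. 212)] -/
theorem sahiConjecture_three_iff_kahnConjecture : SahiConjecture 3 ↔ KahnConjecture := by
  rw [kahnConjecture_iff_sahiPositive, sahiConjecture_iff_forall_bernoulliWeight]

/-- The full hierarchy in product form: `(∀ n, C_n) ↔` every product weight on a finite cube is
Sahi-positive of every order. [cite: Kahn2022, p. 3 (before Conj. 5); LiebSahi2021, Conj. 1.1] -/
theorem forall_sahiConjecture_iff_forall_bernoulliWeight :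
    (∀ n, SahiConjecture n) ↔
      ∀ (n : ℕ) (ι : Type) [Fintype ι] (p : ι → unitInterval), SahiPositive (bernoulliWeight p) n :=
  forall_congr' fun n => sahiConjecture_iff_forall_bernoulliWeight n

/-- **Lieb–Sahi's generality costs nothing**: the obligation `SahiConjecture n` (all finite distributive
lattices = FKG posets [LiebSahi2021, Conj. 1.1]) is equivalent to Sahi's verbatim setting, the Boolean lattices
`2^X` with an FKG probability weight [Sahi2008, Conj. 5 (p. 212), eq. (8)] — since it is already equivalent to
the product weights on `2^X`. [cite: Sahi2008, Conj. 5 (p. 212); LiebSahi2021, Conj. 1.1; Kahn2022, p. 3] -/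
theorem sahiConjecture_iff_forall_set (n : ℕ) :
    SahiConjecture n ↔ ∀ (X : Type) [Fintype X] (μ : Set X → ℝ), IsFKGMeasure μ → SahiPositive μ n :=
  ⟨fun h X _ μ hμ => h (Set X) μ hμ,
    fun h => (sahiConjecture_iff_forall_bernoulliWeight n).2 fun ι _ p =>
      h ι (bernoulliWeight p) (isFKGMeasure_bernoulliWeight p)⟩

end Summit.CriticalPhenomena.PercolationContinuityZ3.Theorems
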